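import Literature.NumberTheory.LFunctions.NicolasJ
import Literature.NumberTheory.LFunctions.ExplicitFormulaPsiOneTrivialZeros
import HarnessLib

/-!
# Nicolas 2012, Lemma 2.5: the explicit formula inside `J(x)` (under RH)

Topic: `Literature/NumberTheory/LFunctions`. THEOREMS (everything proved, nothing asserted).
J.-L. Nicolas, *Small values of the Euler function and the Riemann hypothesis*, Acta Arith. 155
(2012), 311–321 (arXiv:1202.0729), Lemma 2.5, (2.14)–(2.15): under RH, for `x > 1`,
`J(x) = −W(x)/(√x log x) − J₁(x) − J₂(x)` with `0 < J₁(x) ≤ log(2π)/(x log x)` and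
`|J₂(x)| ≤ β(1 + 4/log x)/(√x log² x)`, where `J(x) = ∫_x^∞ (ψ(t) − t) t^{−2}(1/log t + 1/log² t) dt`
((1.16); the tree's `Literature.NumberTheory.LFunctions.NicolasJ.nicolasJ`), `W(x) = ∑_ρ x^{i Im ρ}/(ρ(1−ρ))`,
`|W(x)| ≤ β = ∑_ρ 1/(ρ(1−ρ))` ((1.18)–(1.19)). We prove the `W`-free consequence that the named fact
`Literature.NumberTheory.LFunctions.Nicolas2012_logf_lower_sharp` ((2.18), `NicolasMertensRH.lean`) consumes:

* `nicolasJ_ge_of_RH` — under RH, for `x > 1`,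
  **`J(x) ≥ −β/(√x log x) − β(1 + 4/log x)/(√x log² x) − log(2π)/(x log x)`**;
* `exists_abs_Rone_le_of_RH` — under RH, `|ψ₁(t) − t²/2| ≤ C t^{3/2}` for `t ≥ 1` (so that (1.16)
  converges to `nicolasJ`, `Literature.NumberTheory.LFunctions.NicolasJ.tendsto_integral_R_mul_w0`).

**Proof** (Nicolas 1983, §2 and 2012, Lemma 2.5, run on the absolutely convergent explicit formula
for `ψ₁` of the tree, `Literature.NumberTheory.LFunctions.psiOne_eq_explicit` with
`Literature.NumberTheory.LFunctions.hasSum_psiOneRemainder_trivialZeros`: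
`ψ₁(t) − t²/2 = −Z(t) − (log 2π) t + E(t)`, `Z(t) = ∑_ρ m(ρ) t^{ρ+1}/(ρ(ρ+1))`,
`E(t) = (ζ'/ζ)(−1) − ∑_{k≥1} m(−2k) t^{1−2k}/(2k(2k−1))`). With `R₁ = ψ₁ − t²/2` and
`J(x) = −R₁(x) w₀(x) − ∫_x^∞ R₁ w₀'` (`w₀(t) = (1/log t + 1/log²t)/t²`):
* zeros: `∫_x^∞ Z w₀' = ∑_ρ ∫_x^∞ m(ρ) t^{ρ+1} w₀'/(ρ(ρ+1))` (dominated convergence, under RH the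
  terms have modulus `≤ m(ρ) t^{3/2}|w₀'(t)|/|ρ|²` and `∑ m(ρ)/|ρ|² = β`), and for each zero
  `x^{ρ+1} w₀(x) + ∫_x^∞ t^{ρ+1} w₀' = −(ρ+1) F_ρ(x)` (`F_z(x) = ∫_x^∞ t^{z−2}(1/log t + 1/log²t) dt`,
  `NicolasFz.lean`), so the zeros contribute `−∑_ρ (m(ρ)/ρ) F_ρ(x)
  = −∑_ρ m(ρ) x^{ρ−1}/(ρ(1−ρ) log x) − ∑_ρ (m(ρ)/ρ) r_ρ(x)` (Lemma 2.2 (2.2)), of real part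
  `≥ −β/(√x log x) − β(1+4/log x)/(√x log²x)` ((1.19) and (2.3));
* the linear term: `x w₀(x) + ∫_x^∞ t w₀'(t) dt = −∫_x^∞ w₀ = −1/(x log x)`;
* the trivial zeros: `Re E` is non-decreasing and `w₀' < 0`, so
  `Re(E(x) w₀(x) + ∫_x^∞ E w₀') ≤ Re E(x) (w₀(x) + ∫_x^∞ w₀') = 0`; this term enters `J` with a
  minus sign, i.e. contributes `≥ 0` (Nicolas's `0 < J₁ ≤ log(2π)/(x log x)` keeps it inside `J₁`).

## References

* J.-L. Nicolas, Acta Arith. 155 (2012), 311–321 (arXiv:1202.0729): (1.16)–(1.19), Lemma 2.2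
  (2.2)–(2.3), Lemma 2.5 (2.14)–(2.15). [Nicolas2012]
* J.-L. Nicolas, J. Number Theory 17 (1983), 375–388, §2 (`J(x) = −∑_ρ F_ρ(x)/ρ − J₁(x)`).
  [Nicolas1983]
* H. L. Montgomery, R. C. Vaughan, *Multiplicative Number Theory I*, CUP 2007, §12.1.1 Ex. 6,
  (13.7). [MontgomeryVaughan2007]
-/

noncomputable section

open Complex Filter Set MeasureTheory Topology
open scoped Real Chebyshev

namespace Literature.NumberTheory.LFunctions

namespace NicolasJExplicit

open NicolasJ NicolasFz

/-- The non-trivial zeros, as a (countable) index type. [folklore] -/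
abbrev Zeros : Type := RHWave0.riemannZetaNontrivialZeros

/-- The non-trivial zeros are countable (the tree's instance for the byte-identical
`ZetaZeros.riemannZetaNontrivialZeros`). [folklore] -/
instance : Countable Zeros :=
  (inferInstance : Countable ZetaZeros.riemannZetaNontrivialZeros)

/-- The `ρ`-th term `m(ρ) t^{ρ+1}/(ρ(ρ+1))` of the explicit formula for `ψ₁`.
[cite: MontgomeryVaughan2007, (13.7)] -/
def zeroTerm (ρ : Zeros) (t : ℝ) : ℂ :=
  (riemannZetaZeroOrder (ρ : ℂ) : ℂ) * ((t : ℂ) ^ ((ρ : ℂ) + 1) / ((ρ : ℂ) * (ρ + 1)))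

/-- `Z(t) = ∑_ρ m(ρ) t^{ρ+1}/(ρ(ρ+1))`. [cite: MontgomeryVaughan2007, (13.7)] -/
def Zsum (t : ℝ) : ℂ := ∑' ρ : Zeros, zeroTerm ρ t

/-! ### Basic facts on the zeros -/

variable {ρ : ℂ}

/-- `0 < Re ρ`. [folklore] -/
theorem re_pos (h : ρ ∈ RHWave0.riemannZetaNontrivialZeros) : 0 < ρ.re :=
  ZetaZeros.riemannZetaNontrivialZeros.re_pos h

/-- `Re ρ < 1`. [folklore] -/
theorem re_lt_one (h : ρ ∈ RHWave0.riemannZetaNontrivialZeros) : ρ.re < 1 :=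
  ZetaZeros.riemannZetaNontrivialZeros.re_lt_one h

/-- `ρ ≠ 0`. [folklore] -/
theorem ne_zero (h : ρ ∈ RHWave0.riemannZetaNontrivialZeros) : ρ ≠ 0 := by
  intro h0; have := re_pos h; rw [h0] at this; simp at this

/-- `ρ + 1 ≠ 0`. [folklore] -/
theorem add_one_ne_zero (h : ρ ∈ RHWave0.riemannZetaNontrivialZeros) : ρ + 1 ≠ 0 := by
  intro h0
  have := re_pos h
  have h1 : (ρ + 1).re = 0 := by rw [h0]; simp
  simp at h1; linarith

/-- `1 − ρ ≠ 0`. [folklore] -/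
theorem one_sub_ne_zero' (h : ρ ∈ RHWave0.riemannZetaNontrivialZeros) : 1 - ρ ≠ 0 := by
  intro h0
  have := re_lt_one h
  have h1 : (1 - ρ).re = 0 := by rw [h0]; simp
  simp at h1; linarith

/-- `|ρ| ≤ |ρ + 1|` (`Re ρ > 0`). [folklore] -/
theorem norm_le_norm_add_one (h : ρ ∈ RHWave0.riemannZetaNontrivialZeros) : ‖ρ‖ ≤ ‖ρ + 1‖ := by
  have hre := re_pos h
  have h1 : ‖ρ‖ ^ 2 ≤ ‖ρ + 1‖ ^ 2 := by
    rw [Complex.sq_norm, Complex.sq_norm, Complex.normSq_apply, Complex.normSq_apply]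
    simp only [add_re, one_re, add_im, one_im, add_zero]
    nlinarith
  exact le_of_sq_le_sq (by linarith) (norm_nonneg _) |> fun _ ↦
    (pow_le_pow_iff_left₀ (norm_nonneg _) (norm_nonneg _) two_ne_zero).1 h1

/-- Under RH every non-trivial zero has real part `1/2`. [folklore] -/
theorem re_eq_half_of_RH (hRH : RiemannHypothesis) (h : ρ ∈ RHWave0.riemannZetaNontrivialZeros) :
    ρ.re = 1 / 2 := by
  refine hRH ρ (ZetaZeros.riemannZetaNontrivialZeros.zeta_eq_zero h) ?_
    (ZetaZeros.riemannZetaNontrivialZeros.ne_one h)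
  rintro ⟨n, hn⟩
  have := re_pos h
  rw [hn] at this
  simp at this
  linarith [(n.cast_nonneg : (0 : ℝ) ≤ n)]

/-- `m(ρ) ≥ 0`. [folklore] -/
theorem zeroOrder_nonneg' (ρ : Zeros) : (0 : ℝ) ≤ riemannZetaZeroOrder (ρ : ℂ) := by
  exact_mod_cast riemannZetaZeroOrder_nonneg (ZetaZeros.riemannZetaNontrivialZeros.ne_one ρ.2)

/-! ### `R₁ = ψ₁ − t²/2` through the explicit formula -/

/-- **`ψ₁(t) − t²/2 = −Z(t) − (log 2π) t + E(t)`** for `t ≥ 1` (the explicit formula of the tree).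
[cite: MontgomeryVaughan2007, (13.7)] -/
theorem Rone_eq_explicit {t : ℝ} (ht : 1 ≤ t) :
    (Rone t : ℂ) = -Zsum t - t * Complex.log (2 * π) + psiOneRemainder t := by
  have h := psiOne_eq_explicit ht
  have hR : (Rone t : ℂ) = (psiOne t : ℂ) - (t : ℂ) ^ 2 / 2 := by
    simp only [Rone]; push_cast; ring
  rw [hR, h, Zsum]
  simp only [zeroTerm]
  ring

/-- `log (2π)` as a complex logarithm is the real logarithm. [folklore] -/
theorem log_two_pi : Complex.log (2 * π) = ((Real.log (2 * π) : ℝ) : ℂ) := by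
  rw [show (2 * π : ℂ) = ((2 * π : ℝ) : ℂ) by push_cast; ring]
  exact (Complex.ofReal_log (by positivity)).symm

/-! ### The weight: integrability facts on `(x, ∞)` -/

/-- `w₀` is integrable on `(x, ∞)`, `x > 1`. [folklore] -/
theorem integrableOn_w0 {x : ℝ} (hx : 1 < x) : IntegrableOn w0 (Ioi x) := by
  have hx0 : 0 < x := by linarith
  have hb : IntegrableOn (fun t : ℝ ↦ (1 / Real.log x + 1 / Real.log x ^ 2) * t ^ (-2 : ℝ)) (Ioi x) :=
    (integrableOn_Ioi_rpow_of_lt (by norm_num) hx0).const_mul _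
  refine hb.mono' ((continuousOn_w0.mono fun t ht ↦ hx.trans ht).aestronglyMeasurable
    measurableSet_Ioi) ((ae_restrict_iff' measurableSet_Ioi).2 (ae_of_all _ fun t ht ↦ ?_))
  have ht0 : 0 < t := hx0.trans ht
  rw [Real.norm_eq_abs, abs_of_pos (w0_pos (hx.trans ht)), Real.rpow_neg ht0.le,
    show (t ^ (2 : ℝ)) = t ^ 2 by norm_cast, ← div_eq_mul_inv]
  exact w0_le hx ht.le

/-- The constant `M_x = 2/log x + 3/log² x + 2/log³ x` bounding `t³ |w₀'(t)|` on `[x, ∞)`. [folklore] -/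
def Mw (x : ℝ) : ℝ := 2 / Real.log x + 3 / Real.log x ^ 2 + 2 / Real.log x ^ 3

/-- `M_x ≥ 0`. [folklore] -/
theorem Mw_nonneg {x : ℝ} (hx : 1 < x) : 0 ≤ Mw x := by
  have := Real.log_pos hx; unfold Mw; positivity

/-- `|w₀'(t)| ≤ M_x t^{-3}` for `t ≥ x > 1`. [folklore] -/
theorem abs_w0'_le_rpow {x t : ℝ} (hx : 1 < x) (ht : x ≤ t) : |w0' t| ≤ Mw x * t ^ (-3 : ℝ) := by
  have ht0 : 0 < t := by linarith
  have h := abs_w0'_le hx ht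
  rw [Real.rpow_neg ht0.le, show t ^ (3 : ℝ) = t ^ 3 by norm_cast, ← div_eq_mul_inv]
  exact h

/-- A model integrability statement: a continuous `g` on `(x,∞)` with `|g(t)| ≤ C t^{a}`, `a < −1`,
is integrable there (`x > 0`). [folklore] -/
theorem integrableOn_of_le_rpow {x a C : ℝ} (hx : 0 < x) (ha : a < -1) {g : ℝ → ℂ}
    (hg : ContinuousOn g (Ioi x)) (hle : ∀ t, x < t → ‖g t‖ ≤ C * t ^ a) :
    IntegrableOn g (Ioi x) := by
  have hb : IntegrableOn (fun t : ℝ ↦ C * t ^ a) (Ioi x) :=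
    (integrableOn_Ioi_rpow_of_lt ha hx).const_mul _
  exact hb.mono' (hg.aestronglyMeasurable measurableSet_Ioi)
    ((ae_restrict_iff' measurableSet_Ioi).2 (ae_of_all _ fun t ht ↦ hle t ht))

/-- `w₀'` is integrable on `(x, ∞)`, `x > 1`, with `∫_x^∞ w₀' = −w₀(x)`. [folklore] -/
theorem integral_w0' {x : ℝ} (hx : 1 < x) :
    IntegrableOn w0' (Ioi x) ∧ ∫ t in Ioi x, w0' t = -w0 x := by
  have hx0 : 0 < x := by linarith
  have hint : IntegrableOn w0' (Ioi x) := by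
    have hb : IntegrableOn (fun t : ℝ ↦ Mw x * t ^ (-3 : ℝ)) (Ioi x) :=
      (integrableOn_Ioi_rpow_of_lt (by norm_num) hx0).const_mul _
    refine hb.mono' ((continuousOn_w0'.mono fun t ht ↦ hx.trans ht).aestronglyMeasurable
      measurableSet_Ioi) ((ae_restrict_iff' measurableSet_Ioi).2 (ae_of_all _ fun t ht ↦ ?_))
    rw [Real.norm_eq_abs]
    exact abs_w0'_le_rpow hx ht.le
  refine ⟨hint, ?_⟩
  have hlim : Tendsto w0 atTop (𝓝 0) := by
    have hmaj : Tendsto (fun t : ℝ ↦ (1 / Real.log x + 1 / Real.log x ^ 2) * t ^ (-2 : ℝ)) atTop (𝓝 0) := by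
      have h := (tendsto_rpow_neg_atTop (y := (2 : ℝ)) (by norm_num)).const_mul
        (1 / Real.log x + 1 / Real.log x ^ 2)
      rw [mul_zero] at h
      exact h
    refine squeeze_zero_norm' ?_ hmaj
    filter_upwards [eventually_ge_atTop x] with t ht
    have ht0 : 0 < t := by linarith
    rw [Real.norm_eq_abs, abs_of_pos (w0_pos (hx.trans_le ht)), Real.rpow_neg ht0.le,
      show (t ^ (2 : ℝ)) = t ^ 2 by norm_cast, ← div_eq_mul_inv]
    exact w0_le hx ht
  have h := integral_Ioi_of_hasDerivAt_of_tendsto' (fun t ht ↦ hasDerivAt_w0 (hx.trans_le ht)) hint hlim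
  rw [h]; ring

/-- **The linear term**: `x w₀(x) + ∫_x^∞ t w₀'(t) dt = −1/(x log x)` (`x > 1`); the integrand is
integrable. [cite: Nicolas2012, Lemma 2.5 (the term `J₁`)] -/
theorem linear_term {x : ℝ} (hx : 1 < x) :
    IntegrableOn (fun t : ℝ ↦ t * w0' t) (Ioi x) ∧
      x * w0 x + ∫ t in Ioi x, t * w0' t = -(1 / (x * Real.log x)) := by
  have hx0 : 0 < x := by linarith
  have hint : IntegrableOn (fun t : ℝ ↦ t * w0' t) (Ioi x) := by
    have hb : IntegrableOn (fun t : ℝ ↦ Mw x * t ^ (-2 : ℝ)) (Ioi x) :=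
      (integrableOn_Ioi_rpow_of_lt (by norm_num) hx0).const_mul _
    refine hb.mono' ?_ ((ae_restrict_iff' measurableSet_Ioi).2 (ae_of_all _ fun t ht ↦ ?_))
    · exact (continuousOn_id.mul (continuousOn_w0'.mono fun t ht ↦ hx.trans ht)).aestronglyMeasurable
        measurableSet_Ioi
    · have ht0 : 0 < t := hx0.trans ht
      rw [Real.norm_eq_abs, abs_mul, abs_of_pos ht0]
      have h := abs_w0'_le_rpow hx ht.le
      calc t * |w0' t| ≤ t * (Mw x * t ^ (-3 : ℝ)) := mul_le_mul_of_nonneg_left h ht0.le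
        _ = Mw x * t ^ (-2 : ℝ) := by
            rw [show (-2 : ℝ) = -3 + 1 by norm_num, Real.rpow_add ht0, Real.rpow_one]; ring
  refine ⟨hint, ?_⟩
  -- `d/dt (t w₀) = w₀ + t w₀'`, `t w₀(t) → 0`
  have hderiv : ∀ t ∈ Ici x, HasDerivAt (fun u : ℝ ↦ u * w0 u) (w0 t + t * w0' t) t := by
    intro t ht
    have h := (hasDerivAt_id' t).mul (hasDerivAt_w0 (hx.trans_le ht))
    rw [one_mul] at h
    exact h
  have hlim : Tendsto (fun u : ℝ ↦ u * w0 u) atTop (𝓝 0) := by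
    have hmaj : Tendsto (fun t : ℝ ↦ (1 / Real.log x + 1 / Real.log x ^ 2) * t ^ (-1 : ℝ)) atTop (𝓝 0) := by
      have h := (tendsto_rpow_neg_atTop (y := (1 : ℝ)) (by norm_num)).const_mul
        (1 / Real.log x + 1 / Real.log x ^ 2)
      rw [mul_zero] at h
      exact h
    refine squeeze_zero_norm' ?_ hmaj
    filter_upwards [eventually_ge_atTop x] with t ht
    have ht0 : 0 < t := by linarith
    rw [Real.norm_eq_abs, abs_mul, abs_of_pos ht0, abs_of_pos (w0_pos (hx.trans_le ht))]
    calc t * w0 t ≤ t * ((1 / Real.log x + 1 / Real.log x ^ 2) / t ^ 2) :=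
          mul_le_mul_of_nonneg_left (w0_le hx ht) ht0.le
      _ = (1 / Real.log x + 1 / Real.log x ^ 2) * t ^ (-1 : ℝ) := by
          rw [Real.rpow_neg ht0.le, Real.rpow_one]; field_simp
  have h := integral_Ioi_of_hasDerivAt_of_tendsto' hderiv ((integrableOn_w0 hx).add hint) hlim
  rw [integral_add (integrableOn_w0 hx) hint, integral_w0 hx] at h
  simp only [zero_sub] at h
  linarith

/-! ### One zero: `x^{ρ+1} w₀(x) + ∫_x^∞ t^{ρ+1} w₀' = −(ρ+1) F_ρ(x)` -/

/-- `t^ρ w₀(t) = t^{ρ−2}(1/log t + 1/log²t)` (`t > 0`): the integrand of `F_ρ`. [folklore] -/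
theorem cpow_mul_w0 {t : ℝ} (ht : 0 < t) (ρ : ℂ) :
    (t : ℂ) ^ ρ * (w0 t : ℂ) = (t : ℂ) ^ (ρ - 2) * (wt t : ℂ) := by
  have ht0 : (t : ℂ) ≠ 0 := by exact_mod_cast ht.ne'
  rw [w0, Complex.ofReal_div, Complex.ofReal_pow, Complex.cpow_sub _ _ ht0, Complex.cpow_ofNat]
  field_simp

/-- `t^{ρ+1} w₀'(t) = t^{ρ−2} · (t³ w₀'(t))` (`t > 0`). [folklore] -/
theorem cpow_add_one_mul_w0' {t : ℝ} (ht : 0 < t) (ρ : ℂ) :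
    (t : ℂ) ^ (ρ + 1) * (w0' t : ℂ) = (t : ℂ) ^ (ρ - 2) * ((t ^ 3 * w0' t : ℝ) : ℂ) := by
  have ht0 : (t : ℂ) ≠ 0 := by exact_mod_cast ht.ne'
  have h : (t : ℂ) ^ (ρ + 1) = (t : ℂ) ^ (ρ - 2) * (t : ℂ) ^ 3 := by
    rw [← Complex.cpow_ofNat, ← Complex.cpow_add _ _ ht0]
    congr 1; ring
  rw [h]; push_cast; ring

/-- `t³ w₀'(t)` is continuous on `[x, ∞)` and bounded by `M_x` (`x > 1`). [folklore] -/
theorem continuousOn_cube_mul_w0' {x : ℝ} (hx : 1 < x) :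
    ContinuousOn (fun t : ℝ ↦ t ^ 3 * w0' t) (Ici x) :=
  ((continuousOn_pow 3).mul (continuousOn_w0'.mono fun _ ht ↦ hx.trans_le ht))

/-- `|t³ w₀'(t)| ≤ M_x` for `t ≥ x > 1`. [folklore] -/
theorem abs_cube_mul_w0'_le {x t : ℝ} (hx : 1 < x) (ht : x ≤ t) : |t ^ 3 * w0' t| ≤ Mw x := by
  have ht0 : 0 < t := by linarith
  have h := abs_w0'_le hx ht
  rw [abs_mul, abs_of_pos (pow_pos ht0 3)]
  calc t ^ 3 * |w0' t| ≤ t ^ 3 * ((2 / Real.log x + 3 / Real.log x ^ 2 + 2 / Real.log x ^ 3) / t ^ 3) :=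
        mul_le_mul_of_nonneg_left h (pow_pos ht0 3).le
    _ = Mw x := by rw [Mw]; field_simp

/-- `t ↦ t^{ρ+1} w₀'(t)` is integrable on `(x, ∞)` for `Re ρ < 1`, `x > 1`. [folklore] -/
theorem integrableOn_cpow_mul_w0' {ρ : ℂ} (hρ : ρ.re < 1) {x : ℝ} (hx : 1 < x) :
    IntegrableOn (fun t : ℝ ↦ (t : ℂ) ^ (ρ + 1) * (w0' t : ℂ)) (Ioi x) := by
  have hx0 : 0 < x := by linarith
  have h := integrableOn_cpow_mul hρ hx (continuousOn_cube_mul_w0' hx) fun t ht ↦ abs_cube_mul_w0'_le hx ht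
  exact h.congr_fun (fun t ht ↦ (cpow_add_one_mul_w0' (hx0.trans ht) ρ).symm) measurableSet_Ioi

/-- `t ↦ t^{ρ} w₀(t)` is integrable on `(x, ∞)` for `Re ρ < 1`, `x > 1`, with integral `F_ρ(x)`.
[cite: Nicolas2012, (1.17)] -/
theorem integral_cpow_mul_w0 {ρ : ℂ} (hρ : ρ.re < 1) {x : ℝ} (hx : 1 < x) :
    IntegrableOn (fun t : ℝ ↦ (t : ℂ) ^ ρ * (w0 t : ℂ)) (Ioi x) ∧
      ∫ t in Ioi x, (t : ℂ) ^ ρ * (w0 t : ℂ) = Fz ρ x := by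
  have hx0 : 0 < x := by linarith
  have heq : EqOn (fun t : ℝ ↦ (t : ℂ) ^ (ρ - 2) * (wt t : ℂ)) (fun t : ℝ ↦ (t : ℂ) ^ ρ * (w0 t : ℂ)) (Ioi x) :=
    fun t ht ↦ (cpow_mul_w0 (hx0.trans ht) ρ).symm
  refine ⟨(integrableOn_Fz hρ hx).congr_fun heq measurableSet_Ioi, ?_⟩
  rw [Fz, setIntegral_congr_fun measurableSet_Ioi heq]

/-- **One zero** (integration by parts on `(x, ∞)`): for `0 < Re ρ < 1` and `x > 1`,
`x^{ρ+1} w₀(x) + ∫_x^∞ t^{ρ+1} w₀'(t) dt = −(ρ+1) F_ρ(x)`.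
[cite: Nicolas1983, §2 (`J(x) = −∑_ρ F_ρ(x)/ρ − J₁(x)`)] -/
theorem one_zero {ρ : ℂ} (hρ0 : 0 < ρ.re) (hρ : ρ.re < 1) {x : ℝ} (hx : 1 < x) :
    (x : ℂ) ^ (ρ + 1) * (w0 x : ℂ) + ∫ t in Ioi x, (t : ℂ) ^ (ρ + 1) * (w0' t : ℂ) =
      -(ρ + 1) * Fz ρ x := by
  have hx0 : 0 < x := by linarith
  have hρ1 : ρ + 1 ≠ 0 := by
    intro h0
    have h1 : (ρ + 1).re = 0 := by rw [h0]; simp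
    simp at h1; linarith
  -- derivative of `f(t) = t^{ρ+1} w₀(t)`
  have hderiv : ∀ t ∈ Ici x, HasDerivAt (fun u : ℝ ↦ (u : ℂ) ^ (ρ + 1) * (w0 u : ℂ))
      ((ρ + 1) * (t : ℂ) ^ ρ * (w0 t : ℂ) + (t : ℂ) ^ (ρ + 1) * (w0' t : ℂ)) t := by
    intro t ht
    have ht1 : 1 < t := hx.trans_le ht
    have ht0 : t ≠ 0 := by linarith
    have h1 : HasDerivAt (fun u : ℝ ↦ (u : ℂ) ^ (ρ + 1)) ((ρ + 1) * (t : ℂ) ^ (ρ + 1 - 1)) t :=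
      hasDerivAt_ofReal_cpow_const ht0 hρ1
    rw [add_sub_cancel_right] at h1
    have h2 : HasDerivAt (fun u : ℝ ↦ (w0 u : ℂ)) ((w0' t : ℝ) : ℂ) t :=
      (hasDerivAt_w0 ht1).ofReal_comp
    exact h1.mul h2
  have hint1 := (integral_cpow_mul_w0 hρ hx).1
  have hint2 := integrableOn_cpow_mul_w0' hρ hx
  have hint : IntegrableOn (fun t : ℝ ↦ (ρ + 1) * (t : ℂ) ^ ρ * (w0 t : ℂ) + (t : ℂ) ^ (ρ + 1) * (w0' t : ℂ))
      (Ioi x) := by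
    have h3 : IntegrableOn (fun t : ℝ ↦ (ρ + 1) * ((t : ℂ) ^ ρ * (w0 t : ℂ)) +
        (t : ℂ) ^ (ρ + 1) * (w0' t : ℂ)) (Ioi x) := (hint1.const_mul (ρ + 1)).add hint2
    exact h3.congr_fun (fun t _ ↦ by ring) measurableSet_Ioi
  -- `f(t) → 0`
  have hlim : Tendsto (fun u : ℝ ↦ (u : ℂ) ^ (ρ + 1) * (w0 u : ℂ)) atTop (𝓝 0) := by
    rw [tendsto_zero_iff_norm_tendsto_zero]
    have hmaj : Tendsto (fun t : ℝ ↦ (1 / Real.log x + 1 / Real.log x ^ 2) * t ^ (ρ.re - 1)) atTop (𝓝 0) := by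
      have h := (tendsto_rpow_neg_atTop (y := 1 - ρ.re) (by linarith)).const_mul
        (1 / Real.log x + 1 / Real.log x ^ 2)
      rw [mul_zero] at h
      refine h.congr fun t ↦ ?_
      rw [show -(1 - ρ.re) = ρ.re - 1 by ring]
    refine squeeze_zero' (Eventually.of_forall fun t ↦ norm_nonneg _) ?_ hmaj
    filter_upwards [eventually_ge_atTop x] with t ht
    have ht0 : 0 < t := by linarith
    rw [norm_mul, Complex.norm_cpow_eq_rpow_re_of_pos ht0, Complex.norm_real, Real.norm_eq_abs,
      abs_of_pos (w0_pos (hx.trans_le ht)), add_re, one_re]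
    calc t ^ (ρ.re + 1) * w0 t ≤ t ^ (ρ.re + 1) * ((1 / Real.log x + 1 / Real.log x ^ 2) / t ^ 2) :=
          mul_le_mul_of_nonneg_left (w0_le hx ht) (by positivity)
      _ = (1 / Real.log x + 1 / Real.log x ^ 2) * t ^ (ρ.re - 1) := by
          have e : t ^ (ρ.re + 1) = t ^ (ρ.re - 1) * t ^ 2 := by
            rw [show (t ^ 2 : ℝ) = t ^ (2 : ℝ) by norm_cast, ← Real.rpow_add ht0]
            congr 1; ring
          rw [e]; field_simp
  have h := integral_Ioi_of_hasDerivAt_of_tendsto' hderiv hint hlim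
  have hsplit : ∫ t in Ioi x, ((ρ + 1) * (t : ℂ) ^ ρ * (w0 t : ℂ) + (t : ℂ) ^ (ρ + 1) * (w0' t : ℂ)) =
      (ρ + 1) * Fz ρ x + ∫ t in Ioi x, (t : ℂ) ^ (ρ + 1) * (w0' t : ℂ) := by
    have e : ∀ t : ℝ, (ρ + 1) * (t : ℂ) ^ ρ * (w0 t : ℂ) + (t : ℂ) ^ (ρ + 1) * (w0' t : ℂ) =
        (ρ + 1) * ((t : ℂ) ^ ρ * (w0 t : ℂ)) + (t : ℂ) ^ (ρ + 1) * (w0' t : ℂ) := fun t ↦ by ring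
    simp_rw [e]
    rw [integral_add (hint1.const_mul _) hint2, integral_const_mul, (integral_cpow_mul_w0 hρ hx).2]
  rw [hsplit, zero_sub] at h
  -- `h : (ρ+1) F + ∫ t^{ρ+1} w₀' = −(x^{ρ+1} w₀(x))`
  linear_combination h

/-! ### The sum over the zeros, under RH -/

/-- Under RH, `‖m(ρ) t^{ρ+1}/(ρ(ρ+1))‖ ≤ (m(ρ)/|ρ|²) t^{3/2}` (`t > 0`). [cite: Nicolas2012, (1.19)] -/
theorem norm_zeroTerm_le (hRH : RiemannHypothesis) (ρ : Zeros) {t : ℝ} (ht : 0 < t) :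
    ‖zeroTerm ρ t‖ ≤ (riemannZetaZeroOrder (ρ : ℂ) : ℝ) / ‖(ρ : ℂ)‖ ^ 2 * t ^ (3 / 2 : ℝ) := by
  have hre := re_eq_half_of_RH hRH ρ.2
  have hm := zeroOrder_nonneg' ρ
  have hn0 : 0 < ‖(ρ : ℂ)‖ := norm_pos_iff.2 (ne_zero ρ.2)
  have hn1 : ‖(ρ : ℂ)‖ ≤ ‖(ρ : ℂ) + 1‖ := norm_le_norm_add_one ρ.2
  rw [zeroTerm, norm_mul, Complex.norm_intCast, abs_of_nonneg hm, norm_div, norm_mul,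
    Complex.norm_cpow_eq_rpow_re_of_pos ht, add_re, one_re, hre,
    show (1 / 2 + 1 : ℝ) = 3 / 2 by norm_num]
  rw [div_mul_eq_mul_div, mul_div_assoc]
  refine mul_le_mul_of_nonneg_left ?_ hm
  rw [div_le_div_iff₀ (mul_pos hn0 (hn0.trans_le hn1)) (pow_pos hn0 2)]
  have ht32 : 0 ≤ t ^ (3 / 2 : ℝ) := Real.rpow_nonneg ht.le _
  nlinarith [mul_le_mul_of_nonneg_left hn1 hn0.le, mul_nonneg ht32 hn0.le]

/-- `zeroTerm ρ t · w₀'(t) = (m(ρ)/(ρ(ρ+1))) · (t^{ρ+1} w₀'(t))`. [folklore] -/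
theorem zeroTerm_mul_w0' (ρ : Zeros) (t : ℝ) :
    zeroTerm ρ t * (w0' t : ℂ) =
      (riemannZetaZeroOrder (ρ : ℂ) : ℂ) / ((ρ : ℂ) * (ρ + 1)) * ((t : ℂ) ^ ((ρ : ℂ) + 1) * (w0' t : ℂ)) := by
  rw [zeroTerm]; ring

/-- Each `zeroTerm ρ · w₀'` is integrable on `(x, ∞)` (`x > 1`). [folklore] -/
theorem integrableOn_zeroTerm_mul_w0' (ρ : Zeros) {x : ℝ} (hx : 1 < x) :
    IntegrableOn (fun t : ℝ ↦ zeroTerm ρ t * (w0' t : ℂ)) (Ioi x) := by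
  have h : IntegrableOn (fun t : ℝ ↦ (riemannZetaZeroOrder (ρ : ℂ) : ℂ) / ((ρ : ℂ) * (ρ + 1)) *
      ((t : ℂ) ^ ((ρ : ℂ) + 1) * (w0' t : ℂ))) (Ioi x) :=
    (integrableOn_cpow_mul_w0' (re_lt_one ρ.2) hx).const_mul _
  exact h.congr_fun (fun t _ ↦ (zeroTerm_mul_w0' ρ t).symm) measurableSet_Ioi

/-- Under RH, `∫_x^∞ ‖zeroTerm ρ · w₀'‖ ≤ (2 M_x/√x) · m(ρ)/|ρ|²` (`x > 1`). [cite: Nicolas2012, (1.19)] -/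
theorem integral_norm_zeroTerm_mul_w0'_le (hRH : RiemannHypothesis) (ρ : Zeros) {x : ℝ} (hx : 1 < x) :
    ∫ t in Ioi x, ‖zeroTerm ρ t * (w0' t : ℂ)‖ ≤
      2 * Mw x * x ^ (-(1 / 2) : ℝ) * ((riemannZetaZeroOrder (ρ : ℂ) : ℝ) / ‖(ρ : ℂ)‖ ^ 2) := by
  have hx0 : 0 < x := by linarith
  set K : ℝ := (riemannZetaZeroOrder (ρ : ℂ) : ℝ) / ‖(ρ : ℂ)‖ ^ 2 with hK
  have hK0 : 0 ≤ K := div_nonneg (zeroOrder_nonneg' ρ) (sq_nonneg _)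
  have hM0 := Mw_nonneg hx
  have hrpow : IntegrableOn (fun t : ℝ ↦ K * Mw x * t ^ (-(3 / 2) : ℝ)) (Ioi x) :=
    (integrableOn_Ioi_rpow_of_lt (by norm_num) hx0).const_mul _
  calc ∫ t in Ioi x, ‖zeroTerm ρ t * (w0' t : ℂ)‖
      ≤ ∫ t in Ioi x, K * Mw x * t ^ (-(3 / 2) : ℝ) := by
        refine setIntegral_mono_on (integrableOn_zeroTerm_mul_w0' ρ hx).norm hrpow measurableSet_Ioi
          fun t ht ↦ ?_
        have ht0 : 0 < t := hx0.trans ht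
        rw [norm_mul, Complex.norm_real, Real.norm_eq_abs]
        have h1 := norm_zeroTerm_le hRH ρ ht0
        have h2 := abs_w0'_le_rpow hx ht.le
        calc ‖zeroTerm ρ t‖ * |w0' t| ≤ (K * t ^ (3 / 2 : ℝ)) * (Mw x * t ^ (-3 : ℝ)) :=
              mul_le_mul h1 h2 (abs_nonneg _) (by positivity)
          _ = K * Mw x * t ^ (-(3 / 2) : ℝ) := by
              rw [show (-(3 / 2) : ℝ) = 3 / 2 + (-3) by norm_num, Real.rpow_add ht0]; ring
    _ = K * Mw x * (2 * x ^ (-(1 / 2) : ℝ)) := by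
        rw [integral_const_mul, integral_Ioi_rpow_of_lt (by norm_num) hx0]
        congr 1
        rw [show (-(3 / 2) + 1 : ℝ) = -(1 / 2) by norm_num]
        ring
    _ = 2 * Mw x * x ^ (-(1 / 2) : ℝ) * K := by ring

/-- Under RH the integrals `∫_x^∞ ‖zeroTerm ρ · w₀'‖` are summable over the zeros (`∑ m(ρ)/|ρ|² = β`).
[cite: Nicolas2012, (1.19)] -/
theorem summable_integral_norm_zeroTerm_mul_w0' (hRH : RiemannHypothesis) {x : ℝ} (hx : 1 < x) :
    Summable fun ρ : Zeros ↦ ∫ t in Ioi x, ‖zeroTerm ρ t * (w0' t : ℂ)‖ := by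
  have hS := (hasSum_zeroOrder_div_norm_sq_of_RH hRH).summable.mul_left (2 * Mw x * x ^ (-(1 / 2) : ℝ))
  refine Summable.of_nonneg_of_le (fun ρ ↦ integral_nonneg fun t ↦ norm_nonneg _)
    (fun ρ ↦ integral_norm_zeroTerm_mul_w0'_le hRH ρ hx) hS

/-- `Z(t)` converges absolutely for `t ≥ 1`. [cite: MontgomeryVaughan2007, (13.7)] -/
theorem summable_zeroTerm {t : ℝ} (ht : 1 ≤ t) : Summable fun ρ : Zeros ↦ zeroTerm ρ t :=
  (summable_norm_psiOne_zeroTerm ht).of_norm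

/-- **Under RH, `∫_x^∞ Z(t) w₀'(t) dt = ∑_ρ ∫_x^∞ zeroTerm ρ · w₀'`** (dominated convergence).
[cite: Nicolas2012, Lemma 2.5 (proof)] -/
theorem integral_Zsum_mul_w0' (hRH : RiemannHypothesis) {x : ℝ} (hx : 1 < x) :
    ∫ t in Ioi x, Zsum t * (w0' t : ℂ) = ∑' ρ : Zeros, ∫ t in Ioi x, zeroTerm ρ t * (w0' t : ℂ) := by
  have h := integral_tsum_of_summable_integral_norm (μ := volume.restrict (Ioi x))
    (F := fun (ρ : Zeros) (t : ℝ) ↦ zeroTerm ρ t * (w0' t : ℂ))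
    (fun ρ ↦ integrableOn_zeroTerm_mul_w0' ρ hx) (summable_integral_norm_zeroTerm_mul_w0' hRH hx)
  rw [h]
  refine integral_congr_ae (ae_of_all _ fun t ↦ ?_)
  simp only [Zsum]
  exact tsum_mul_right.symm

/-- **The zeros' bracket**: under RH, for `x > 1`,
`Z(x) w₀(x) + ∫_x^∞ Z w₀' = −∑_ρ (m(ρ)/ρ) F_ρ(x)`, and this last series converges.
[cite: Nicolas1983, §2 (`J = −∑_ρ F_ρ/ρ − J₁`)] -/
theorem zeros_bracket (hRH : RiemannHypothesis) {x : ℝ} (hx : 1 < x) :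
    Summable (fun ρ : Zeros ↦ (riemannZetaZeroOrder (ρ : ℂ) : ℂ) / (ρ : ℂ) * Fz (ρ : ℂ) x) ∧
    Zsum x * (w0 x : ℂ) + ∫ t in Ioi x, Zsum t * (w0' t : ℂ) =
      -∑' ρ : Zeros, (riemannZetaZeroOrder (ρ : ℂ) : ℂ) / (ρ : ℂ) * Fz (ρ : ℂ) x := by
  have hx0 : 0 < x := by linarith
  -- per zero
  have hper : ∀ ρ : Zeros, zeroTerm ρ x * (w0 x : ℂ) + ∫ t in Ioi x, zeroTerm ρ t * (w0' t : ℂ) =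
      -((riemannZetaZeroOrder (ρ : ℂ) : ℂ) / (ρ : ℂ) * Fz (ρ : ℂ) x) := by
    intro ρ
    have hρ0 : (ρ : ℂ) ≠ 0 := ne_zero ρ.2
    have hρ1 : (ρ : ℂ) + 1 ≠ 0 := add_one_ne_zero ρ.2
    have h1 := one_zero (re_pos ρ.2) (re_lt_one ρ.2) hx (ρ := (ρ : ℂ))
    have hint : ∫ t in Ioi x, zeroTerm ρ t * (w0' t : ℂ) =
        (riemannZetaZeroOrder (ρ : ℂ) : ℂ) / ((ρ : ℂ) * (ρ + 1)) *
          ∫ t in Ioi x, (t : ℂ) ^ ((ρ : ℂ) + 1) * (w0' t : ℂ) := by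
      rw [← integral_const_mul]
      exact integral_congr_ae (ae_of_all _ fun t ↦ zeroTerm_mul_w0' ρ t)
    rw [hint, zeroTerm]
    have e : (riemannZetaZeroOrder (ρ : ℂ) : ℂ) * ((x : ℂ) ^ ((ρ : ℂ) + 1) / ((ρ : ℂ) * (ρ + 1))) * (w0 x : ℂ) +
        (riemannZetaZeroOrder (ρ : ℂ) : ℂ) / ((ρ : ℂ) * (ρ + 1)) *
          ∫ t in Ioi x, (t : ℂ) ^ ((ρ : ℂ) + 1) * (w0' t : ℂ) =
        (riemannZetaZeroOrder (ρ : ℂ) : ℂ) / ((ρ : ℂ) * (ρ + 1)) *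
          ((x : ℂ) ^ ((ρ : ℂ) + 1) * (w0 x : ℂ) + ∫ t in Ioi x, (t : ℂ) ^ ((ρ : ℂ) + 1) * (w0' t : ℂ)) := by
      field_simp
    rw [e, h1]
    field_simp
  -- summability of the two families
  have hs1 : Summable fun ρ : Zeros ↦ zeroTerm ρ x * (w0 x : ℂ) := (summable_zeroTerm hx.le).mul_right _
  have hs2 : Summable fun ρ : Zeros ↦ ∫ t in Ioi x, zeroTerm ρ t * (w0' t : ℂ) :=
    (summable_integral_norm_zeroTerm_mul_w0' hRH hx).of_norm_bounded fun ρ ↦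
      norm_integral_le_integral_norm _
  have hs3 : Summable fun ρ : Zeros ↦ -((riemannZetaZeroOrder (ρ : ℂ) : ℂ) / (ρ : ℂ) * Fz (ρ : ℂ) x) := by
    have := hs1.add hs2
    exact this.congr hper
  refine ⟨by simpa using hs3.neg, ?_⟩
  rw [integral_Zsum_mul_w0' hRH hx, Zsum, ← tsum_mul_right, ← hs1.tsum_add hs2, ← tsum_neg]
  exact tsum_congr hper

/-- The size of `J₂`: `D_x = (1 + 4/log x)/(√x log² x)`. [cite: Nicolas2012, Lemma 2.5 (2.15)] -/
def Dx (x : ℝ) : ℝ := (1 + 4 / Real.log x) / (Real.sqrt x * Real.log x ^ 2)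

/-- `D_x > 0` for `x > 1`. [folklore] -/
theorem Dx_pos {x : ℝ} (hx : 1 < x) : 0 < Dx x := by
  have := Real.log_pos hx
  have : 0 < Real.sqrt x := Real.sqrt_pos.2 (by linarith)
  unfold Dx; positivity

/-- **Real part of the zeros' bracket** (Nicolas 2012, (2.14)–(2.15) with (1.19)): under RH, for
`x > 1`, `Re(−∑_ρ (m(ρ)/ρ) F_ρ(x)) ≥ −β/(√x log x) − β D_x`.
[cite: Nicolas2012, Lemma 2.5 (2.14)–(2.15)] -/
theorem re_zeros_bracket_ge (hRH : RiemannHypothesis) {x : ℝ} (hx : 1 < x) :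
    -nicolasBeta / (Real.sqrt x * Real.log x) - nicolasBeta * Dx x ≤
      (-∑' ρ : Zeros, (riemannZetaZeroOrder (ρ : ℂ) : ℂ) / (ρ : ℂ) * Fz (ρ : ℂ) x).re := by
  have hx0 : 0 < x := by linarith
  have hlx : 0 < Real.log x := Real.log_pos hx
  have hsx : 0 < Real.sqrt x := Real.sqrt_pos.2 hx0
  have hD := Dx_pos hx
  -- the two coefficient families
  set c₁ : ℂ → ℂ := fun ρ ↦ (x : ℂ) ^ (ρ - 1) * (Real.sqrt x : ℂ) with hc₁
  set c₂ : ℂ → ℂ := fun ρ ↦ (1 - ρ) * rz ρ x / (Dx x : ℂ) with hc₂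
  have hc₁le : ∀ ρ ∈ RHWave0.riemannZetaNontrivialZeros, ‖c₁ ρ‖ ≤ 1 := by
    intro ρ hρ
    have hre := re_eq_half_of_RH hRH hρ
    rw [hc₁]
    simp only
    rw [norm_mul, Complex.norm_cpow_eq_rpow_re_of_pos hx0, sub_re, one_re, hre, Complex.norm_real,
      Real.norm_eq_abs, abs_of_pos hsx, Real.sqrt_eq_rpow, ← Real.rpow_add hx0]
    norm_num
  have hc₂le : ∀ ρ ∈ RHWave0.riemannZetaNontrivialZeros, ‖c₂ ρ‖ ≤ 1 := by
    intro ρ hρ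
    have hre := re_eq_half_of_RH hRH hρ
    have h1ρ : 1 - ρ ≠ 0 := one_sub_ne_zero' hρ
    have hn : 0 < ‖1 - ρ‖ := norm_pos_iff.2 h1ρ
    have hr := norm_rz_le hre hx
    rw [hc₂]
    simp only
    rw [norm_div, norm_mul, Complex.norm_real, Real.norm_eq_abs, abs_of_pos hD, div_le_one hD]
    calc ‖1 - ρ‖ * ‖rz ρ x‖ ≤ ‖1 - ρ‖ * ((1 + 4 / Real.log x) / (‖1 - ρ‖ * Real.sqrt x * Real.log x ^ 2)) :=
          mul_le_mul_of_nonneg_left hr hn.le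
      _ = Dx x := by rw [Dx]; field_simp
  obtain ⟨hsum₁, hle₁⟩ := norm_tsum_zeroOrder_mul_div_le_nicolasBeta hRH hc₁le
  obtain ⟨hsum₂, hle₂⟩ := norm_tsum_zeroOrder_mul_div_le_nicolasBeta hRH hc₂le
  set T₁ : Zeros → ℂ := fun ρ ↦ (riemannZetaZeroOrder (ρ : ℂ) : ℂ) * c₁ ρ / ((ρ : ℂ) * (1 - ρ)) with hT₁
  set T₂ : Zeros → ℂ := fun ρ ↦ (riemannZetaZeroOrder (ρ : ℂ) : ℂ) * c₂ ρ / ((ρ : ℂ) * (1 - ρ)) with hT₂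
  set a : ℝ := 1 / (Real.sqrt x * Real.log x) with ha
  -- termwise decomposition `−(m/ρ) F_ρ = −a T₁ − D T₂`
  have hterm : ∀ ρ : Zeros, -((riemannZetaZeroOrder (ρ : ℂ) : ℂ) / (ρ : ℂ) * Fz (ρ : ℂ) x) =
      -(a : ℂ) * T₁ ρ - (Dx x : ℂ) * T₂ ρ := by
    intro ρ
    have hρ0 : (ρ : ℂ) ≠ 0 := ne_zero ρ.2
    have h1ρ : 1 - (ρ : ℂ) ≠ 0 := one_sub_ne_zero' ρ.2
    have hDC : (Dx x : ℂ) ≠ 0 := by exact_mod_cast hD.ne'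
    have hsC : (Real.sqrt x : ℂ) ≠ 0 := by exact_mod_cast hsx.ne'
    have hlC : (Real.log x : ℂ) ≠ 0 := by exact_mod_cast hlx.ne'
    rw [Fz_eq (re_lt_one ρ.2) hx, hT₁, hT₂, hc₁, hc₂, ha]
    simp only
    push_cast
    field_simp
    ring
  have hs₁ : Summable T₁ := hsum₁.of_norm
  have hs₂ : Summable T₂ := hsum₂.of_norm
  have htsum : -∑' ρ : Zeros, (riemannZetaZeroOrder (ρ : ℂ) : ℂ) / (ρ : ℂ) * Fz (ρ : ℂ) x =
      -(a : ℂ) * ∑' ρ, T₁ ρ - (Dx x : ℂ) * ∑' ρ, T₂ ρ := by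
    rw [← tsum_neg, tsum_congr hterm, ← tsum_mul_left, ← tsum_mul_left,
      ← (hs₁.mul_left _).tsum_sub (hs₂.mul_left _)]
  rw [htsum, sub_re, mul_re, mul_re]
  simp only [neg_re, Complex.ofReal_re, neg_im, Complex.ofReal_im, neg_zero, zero_mul, sub_zero]
  have ha0 : 0 ≤ a := by rw [ha]; positivity
  have h1 : (∑' ρ, T₁ ρ).re ≤ nicolasBeta := (re_le_norm _).trans hle₁
  have h1' : -nicolasBeta ≤ (∑' ρ, T₁ ρ).re := by
    have := (abs_re_le_norm (∑' ρ, T₁ ρ)).trans hle₁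
    exact (abs_le.1 this).1
  have h2 : (∑' ρ, T₂ ρ).re ≤ nicolasBeta := (re_le_norm _).trans hle₂
  have e : -nicolasBeta / (Real.sqrt x * Real.log x) = -(a * nicolasBeta) := by rw [ha]; ring
  rw [e]
  nlinarith [mul_le_mul_of_nonneg_left h1 ha0, mul_le_mul_of_nonneg_left h2 hD.le]

/-! ### Continuity of `Z` and of the remainder `E` -/

/-- `‖zeroTerm ρ 1‖ = m(ρ)/|ρ(ρ+1)|`, and on `[1, X]` every term is at most `X²` times this. [folklore] -/
theorem norm_zeroTerm_le_sq_mul (ρ : Zeros) {X t : ℝ} (ht : t ∈ Icc 1 X) :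
    ‖zeroTerm ρ t‖ ≤ X ^ 2 * ‖zeroTerm ρ 1‖ := by
  have ht0 : 0 < t := by linarith [ht.1]
  have hX1 : 1 ≤ X := ht.1.trans ht.2
  have hm := zeroOrder_nonneg' ρ
  have hre0 := re_pos ρ.2
  have hre1 := re_lt_one ρ.2
  rw [zeroTerm, zeroTerm, norm_mul, norm_mul, norm_div, norm_div, Complex.norm_intCast, abs_of_nonneg hm,
    Complex.norm_cpow_eq_rpow_re_of_pos ht0, Complex.ofReal_one, Complex.one_cpow, norm_one, add_re, one_re]
  have hden : 0 < ‖(ρ : ℂ) * (ρ + 1)‖ := norm_pos_iff.2 (mul_ne_zero (ne_zero ρ.2) (add_one_ne_zero ρ.2))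
  have hpow : t ^ (((ρ : ℂ)).re + 1) ≤ X ^ 2 := by
    calc t ^ (((ρ : ℂ)).re + 1) ≤ X ^ (((ρ : ℂ)).re + 1) :=
          Real.rpow_le_rpow ht0.le ht.2 (by linarith)
      _ ≤ X ^ (2 : ℝ) := Real.rpow_le_rpow_of_exponent_le hX1 (by linarith)
      _ = X ^ 2 := by norm_cast
  calc (riemannZetaZeroOrder (ρ : ℂ) : ℝ) * (t ^ (((ρ : ℂ)).re + 1) / ‖(ρ : ℂ) * (ρ + 1)‖)
      ≤ (riemannZetaZeroOrder (ρ : ℂ) : ℝ) * (X ^ 2 / ‖(ρ : ℂ) * (ρ + 1)‖) :=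
        mul_le_mul_of_nonneg_left (div_le_div_of_nonneg_right hpow hden.le) hm
    _ = X ^ 2 * ((riemannZetaZeroOrder (ρ : ℂ) : ℝ) * (1 / ‖(ρ : ℂ) * (ρ + 1)‖)) := by ring

/-- `Z` is continuous on `[1, X]` (uniform convergence). [folklore] -/
theorem continuousOn_Zsum_Icc (X : ℝ) : ContinuousOn Zsum (Icc 1 X) := by
  have hu : Summable fun ρ : Zeros ↦ X ^ 2 * ‖zeroTerm ρ 1‖ :=
    (summable_norm_psiOne_zeroTerm le_rfl).mul_left _
  refine continuousOn_tsum (fun ρ ↦ ?_) hu fun ρ t ht ↦ norm_zeroTerm_le_sq_mul ρ ht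
  have hc : Continuous fun t : ℝ ↦ (t : ℂ) ^ ((ρ : ℂ) + 1) :=
    continuous_ofReal_cpow_const (by rw [add_re, one_re]; linarith [re_pos ρ.2])
  exact (continuous_const.mul (hc.div_const _)).continuousOn

/-- **`Z` is continuous on `[1, ∞)`.** [folklore] -/
theorem continuousOn_Zsum : ContinuousOn Zsum (Ici 1) := by
  intro t ht
  have h1 : ContinuousWithinAt Zsum (Icc 1 (t + 1)) t := continuousOn_Zsum_Icc (t + 1) t ⟨ht, by linarith⟩
  refine h1.mono_of_mem_nhdsWithin ?_
  have : Iio (t + 1) ∈ 𝓝 t := Iio_mem_nhds (by linarith)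
  filter_upwards [self_mem_nhdsWithin, mem_nhdsWithin_of_mem_nhds this] with s hs hs'
  exact ⟨hs, hs'.le⟩

/-- **The remainder `E` of the explicit formula is continuous on `[1, ∞)`** (it is
`ψ₁ − t²/2 + Z + (log 2π) t`). [cite: MontgomeryVaughan2007, (13.7)] -/
theorem continuousOn_psiOneRemainder : ContinuousOn (fun t : ℝ ↦ psiOneRemainder t) (Ici 1) := by
  have heq : EqOn (fun t : ℝ ↦ (Rone t : ℂ) + Zsum t + t * Complex.log (2 * π))
      (fun t : ℝ ↦ psiOneRemainder t) (Ici 1) := by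
    intro t ht
    simp only
    rw [Rone_eq_explicit ht]
    ring
  refine ContinuousOn.congr ?_ heq.symm
  refine ((Complex.continuous_ofReal.comp continuous_Rone).continuousOn.add continuousOn_Zsum).add ?_
  exact (Complex.continuous_ofReal.mul continuous_const).continuousOn

/-- **`Re E` is non-decreasing on `(1, ∞)`**: `Re((ζ'/ζ)(−1) − E(t)) = ∑_k m(−2k) t^{1−2k}/(2k(2k−1))`
is a convergent series of non-negative non-increasing functions. [cite: MontgomeryVaughan2007, §12.1.1 Exercise 6] -/
theorem re_psiOneRemainder_mono {s t : ℝ} (hs : 1 < s) (hst : s ≤ t) :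
    (psiOneRemainder s).re ≤ (psiOneRemainder t).re := by
  have ht : 1 < t := hs.trans_le hst
  have hS := hasSum_psiOneRemainder_trivialZeros_re hs
  have hT := hasSum_psiOneRemainder_trivialZeros_re ht
  have hle : ∀ k : ℕ, (riemannZetaZeroOrder (-2 * ((k : ℂ) + 1)) : ℝ) *
      (t ^ (-(2 * (k : ℝ) + 1)) / ((2 * k + 2) * (2 * k + 1))) ≤
      (riemannZetaZeroOrder (-2 * ((k : ℂ) + 1)) : ℝ) *
      (s ^ (-(2 * (k : ℝ) + 1)) / ((2 * k + 2) * (2 * k + 1))) := by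
    intro k
    have hm : (0 : ℝ) ≤ riemannZetaZeroOrder (-2 * ((k : ℂ) + 1)) := by
      exact_mod_cast (riemannZetaZeroOrder_trivial_pos k).le
    refine mul_le_mul_of_nonneg_left (div_le_div_of_nonneg_right ?_ (by positivity)) hm
    exact Real.rpow_le_rpow_of_nonpos (by linarith) hst (by nlinarith [(k.cast_nonneg : (0 : ℝ) ≤ k)])
  have h := hasSum_le hle hT hS
  simp only [sub_re] at h
  linarith

/-! ### The remainder's bracket is non-positive -/

/-- Under `‖E(t)‖ ≤ C√t`, `E · w₀'` is integrable on `(x, ∞)`, `x > 1`. [folklore] -/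
theorem integrableOn_psiOneRemainder_mul_w0' {x C : ℝ} (hx : 1 < x)
    (hC : ∀ t : ℝ, 0 < t → ‖psiOneRemainder t‖ ≤ C * Real.sqrt t) :
    IntegrableOn (fun t : ℝ ↦ psiOneRemainder t * (w0' t : ℂ)) (Ioi x) := by
  have hx0 : 0 < x := by linarith
  refine integrableOn_of_le_rpow hx0 (a := -(5 / 2)) (C := C * Mw x) (by norm_num) ?_ fun t ht ↦ ?_
  · exact (continuousOn_psiOneRemainder.mono fun t ht ↦ (hx.trans ht).le).mul
      (Complex.continuous_ofReal.comp_continuousOn (continuousOn_w0'.mono fun t ht ↦ hx.trans ht))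
  · have ht0 : 0 < t := hx0.trans ht
    rw [norm_mul, Complex.norm_real, Real.norm_eq_abs]
    have h1 := hC t ht0
    have h2 := abs_w0'_le_rpow hx ht.le
    calc ‖psiOneRemainder t‖ * |w0' t| ≤ (C * Real.sqrt t) * (Mw x * t ^ (-3 : ℝ)) :=
          mul_le_mul h1 h2 (abs_nonneg _) ((norm_nonneg _).trans h1)
      _ = C * Mw x * t ^ (-(5 / 2) : ℝ) := by
          rw [Real.sqrt_eq_rpow, show (-(5 / 2) : ℝ) = 1 / 2 + (-3) by norm_num, Real.rpow_add ht0]; ring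

/-- **The remainder's bracket**: `Re(E(x) w₀(x) + ∫_x^∞ E w₀') ≤ 0` for `x > 1` (`Re E` is
non-decreasing, `w₀' < 0`, `∫_x^∞ w₀' = −w₀(x)`). [cite: Nicolas2012, Lemma 2.5 (the term `J₁`)] -/
theorem re_remainder_bracket_nonpos {x C : ℝ} (hx : 1 < x)
    (hC : ∀ t : ℝ, 0 < t → ‖psiOneRemainder t‖ ≤ C * Real.sqrt t) :
    (psiOneRemainder x * (w0 x : ℂ) + ∫ t in Ioi x, psiOneRemainder t * (w0' t : ℂ)).re ≤ 0 := by
  have hint := integrableOn_psiOneRemainder_mul_w0' hx hC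
  obtain ⟨hint', hval⟩ := integral_w0' hx
  rw [add_re, mul_re, Complex.ofReal_re, Complex.ofReal_im, mul_zero, sub_zero]
  have hre : (∫ t in Ioi x, psiOneRemainder t * (w0' t : ℂ)).re =
      ∫ t in Ioi x, (psiOneRemainder t).re * w0' t := by
    have h := integral_re hint
    simp only [RCLike.re_to_complex, mul_re, Complex.ofReal_re, Complex.ofReal_im, mul_zero,
      sub_zero] at h
    exact h.symm
  rw [hre]
  have hmono : ∫ t in Ioi x, (psiOneRemainder t).re * w0' t ≤ ∫ t in Ioi x, (psiOneRemainder x).re * w0' t := by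
    refine setIntegral_mono_on ?_ (hint'.const_mul _) measurableSet_Ioi fun t ht ↦ ?_
    · have h0 : Integrable (fun t : ℝ ↦ (psiOneRemainder t).re * w0' t) (volume.restrict (Ioi x)) := by
        simpa [RCLike.re_to_complex] using hint.re
      exact h0
    · have h1 := re_psiOneRemainder_mono hx ht.le
      have h2 := (w0'_neg (hx.trans ht)).le
      nlinarith
  rw [integral_const_mul, hval] at hmono
  linarith

/-! ### Assembly: Lemma 2.5 in its `W`-free form -/

/-- Under RH, `Z · w₀'` is integrable on `(x, ∞)`, `x > 1` (`‖Z(t)‖ ≤ β t^{3/2}`). [folklore] -/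
theorem integrableOn_Zsum_mul_w0' (hRH : RiemannHypothesis) {x : ℝ} (hx : 1 < x) :
    IntegrableOn (fun t : ℝ ↦ Zsum t * (w0' t : ℂ)) (Ioi x) := by
  have hx0 : 0 < x := by linarith
  refine integrableOn_of_le_rpow hx0 (a := -(3 / 2)) (C := nicolasBeta * Mw x) (by norm_num) ?_ fun t ht ↦ ?_
  · exact (continuousOn_Zsum.mono fun t ht ↦ (hx.trans ht).le).mul
      (Complex.continuous_ofReal.comp_continuousOn (continuousOn_w0'.mono fun t ht ↦ hx.trans ht))
  · have ht0 : 0 < t := hx0.trans ht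
    rw [norm_mul, Complex.norm_real, Real.norm_eq_abs]
    have h1 : ‖Zsum t‖ ≤ nicolasBeta * t ^ (3 / 2 : ℝ) := norm_psiOne_zeroSum_le_of_RH hRH (hx.trans ht).le
    have h2 := abs_w0'_le_rpow hx ht.le
    have hβ := (nicolasBeta_gt).le
    calc ‖Zsum t‖ * |w0' t| ≤ (nicolasBeta * t ^ (3 / 2 : ℝ)) * (Mw x * t ^ (-3 : ℝ)) :=
          mul_le_mul h1 h2 (abs_nonneg _) (by positivity)
      _ = nicolasBeta * Mw x * t ^ (-(3 / 2) : ℝ) := by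
          rw [show (-(3 / 2) : ℝ) = 3 / 2 + (-3) by norm_num, Real.rpow_add ht0]; ring

/-- **Nicolas 2012, Lemma 2.5 in `W`-free form**: under RH, for `x > 1`,
`J(x) ≥ −β/(√x log x) − β(1 + 4/log x)/(√x log² x) − log(2π)/(x log x)`
((2.14)–(2.15) combined with `|W(x)| ≤ β`, (1.19), and `J₁ ≤ log(2π)/(x log x)`).
[cite: Nicolas2012, Lemma 2.5 (2.14)–(2.15)] -/
theorem nicolasJ_ge_of_RH (hRH : RiemannHypothesis) {x : ℝ} (hx : 1 < x) :
    -nicolasBeta / (Real.sqrt x * Real.log x)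
        - nicolasBeta * ((1 + 4 / Real.log x) / (Real.sqrt x * Real.log x ^ 2))
        - Real.log (2 * π) / (x * Real.log x) ≤ nicolasJ x := by
  have hx0 : 0 < x := by linarith
  obtain ⟨C, -, hC⟩ := exists_norm_psiOneRemainder_le
  -- the three integrable pieces
  have hiZ := integrableOn_Zsum_mul_w0' hRH hx
  obtain ⟨hiLr, hL⟩ := linear_term hx
  have hiL : IntegrableOn (fun t : ℝ ↦ (t : ℂ) * (w0' t : ℂ)) (Ioi x) := by
    have h0 : IntegrableOn (fun t : ℝ ↦ ((t * w0' t : ℝ) : ℂ)) (Ioi x) := hiLr.ofReal (𝕜 := ℂ)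
    refine h0.congr_fun (fun t _ ↦ by push_cast; ring) measurableSet_Ioi
  have hiE := integrableOn_psiOneRemainder_mul_w0' hx hC
  obtain ⟨-, hZ⟩ := zeros_bracket hRH hx
  have hZre := re_zeros_bracket_ge hRH hx
  have hE := re_remainder_bracket_nonpos hx hC
  -- `J` as a complex number
  have hJ : (nicolasJ x : ℂ) = -(Rone x : ℂ) * (w0 x : ℂ) - ∫ t in Ioi x, (Rone t : ℂ) * (w0' t : ℂ) := by
    rw [nicolasJ]
    push_cast
    rw [← integral_complex_ofReal]
    congr 1
    refine setIntegral_congr_fun measurableSet_Ioi fun t _ ↦ ?_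
    push_cast; ring
  -- substitute the explicit formula
  have hRx := Rone_eq_explicit hx.le
  have hint_eq : ∫ t in Ioi x, (Rone t : ℂ) * (w0' t : ℂ) =
      -(∫ t in Ioi x, Zsum t * (w0' t : ℂ)) - Complex.log (2 * π) * (∫ t in Ioi x, (t : ℂ) * (w0' t : ℂ)) +
        ∫ t in Ioi x, psiOneRemainder t * (w0' t : ℂ) := by
    have h1 : ∫ t in Ioi x, (Rone t : ℂ) * (w0' t : ℂ) =
        ∫ t in Ioi x, (-(Zsum t * (w0' t : ℂ)) - Complex.log (2 * π) * ((t : ℂ) * (w0' t : ℂ)) +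
          psiOneRemainder t * (w0' t : ℂ)) := by
      refine setIntegral_congr_fun measurableSet_Ioi fun t ht ↦ ?_
      rw [Rone_eq_explicit (hx.trans ht).le]; ring
    have hA : IntegrableOn (fun t : ℝ ↦ -(Zsum t * (w0' t : ℂ)) - Complex.log (2 * π) * ((t : ℂ) * (w0' t : ℂ)))
        (Ioi x) := hiZ.neg.sub (hiL.const_mul _)
    have hN : IntegrableOn (fun t : ℝ ↦ -(Zsum t * (w0' t : ℂ))) (Ioi x) := hiZ.neg
    have hM : IntegrableOn (fun t : ℝ ↦ Complex.log (2 * π) * ((t : ℂ) * (w0' t : ℂ))) (Ioi x) :=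
      hiL.const_mul _
    rw [h1, integral_add hA hiE, integral_sub hN hM, integral_neg, integral_const_mul]
  have hLC : (x : ℂ) * (w0 x : ℂ) + ∫ t in Ioi x, (t : ℂ) * (w0' t : ℂ) = ((-(1 / (x * Real.log x)) : ℝ) : ℂ) := by
    rw [← hL]
    push_cast
    rw [← integral_complex_ofReal]
    congr 1
    refine setIntegral_congr_fun measurableSet_Ioi fun t _ ↦ ?_
    push_cast; ring
  have key : (nicolasJ x : ℂ) =
      (Zsum x * (w0 x : ℂ) + ∫ t in Ioi x, Zsum t * (w0' t : ℂ)) +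
        Complex.log (2 * π) * ((x : ℂ) * (w0 x : ℂ) + ∫ t in Ioi x, (t : ℂ) * (w0' t : ℂ)) -
        (psiOneRemainder x * (w0 x : ℂ) + ∫ t in Ioi x, psiOneRemainder t * (w0' t : ℂ)) := by
    rw [hJ, hint_eq, hRx]; ring
  rw [hZ, hLC, log_two_pi] at key
  have hre : nicolasJ x =
      (-∑' ρ : Zeros, (riemannZetaZeroOrder (ρ : ℂ) : ℂ) / (ρ : ℂ) * Fz (ρ : ℂ) x).re +
        Real.log (2 * π) * (-(1 / (x * Real.log x))) -
        (psiOneRemainder x * (w0 x : ℂ) + ∫ t in Ioi x, psiOneRemainder t * (w0' t : ℂ)).re := by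
    have h := congrArg Complex.re key
    rw [Complex.ofReal_re, sub_re, add_re, ← Complex.ofReal_mul, Complex.ofReal_re] at h
    exact h
  rw [hre]
  have e : Real.log (2 * π) * (-(1 / (x * Real.log x))) = -(Real.log (2 * π) / (x * Real.log x)) := by ring
  rw [e]
  rw [Dx] at hZre
  linarith [hZre, hE]

/-- **Under RH, `|ψ₁(t) − t²/2| ≤ C t^{3/2}` for `t ≥ 1`** (the explicit formula: `β t^{3/2}` from the
zeros, `(log 2π) t` and `O(√t)` from the rest), the hypothesis of
`Literature.NumberTheory.LFunctions.NicolasJ.tendsto_integral_R_mul_w0`. [cite: MontgomeryVaughan2007, (13.8)] -/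
theorem exists_abs_Rone_le_of_RH (hRH : RiemannHypothesis) :
    ∃ C : ℝ, ∀ t : ℝ, 1 ≤ t → |Rone t| ≤ C * t ^ (3 / 2 : ℝ) := by
  obtain ⟨C, hC0, hC⟩ := exists_norm_psiOneRemainder_le
  refine ⟨nicolasBeta + Real.log (2 * π) + C, fun t ht ↦ ?_⟩
  have ht0 : 0 < t := by linarith
  have hβ := (nicolasBeta_gt).le
  have hlog : 0 ≤ Real.log (2 * π) := Real.log_nonneg (by linarith [Real.pi_gt_three])
  have h1 : ‖Zsum t‖ ≤ nicolasBeta * t ^ (3 / 2 : ℝ) := norm_psiOne_zeroSum_le_of_RH hRH ht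
  have h2 : ‖(t : ℂ) * Complex.log (2 * π)‖ = t * Real.log (2 * π) := by
    rw [log_two_pi, norm_mul, Complex.norm_real, Complex.norm_real, Real.norm_eq_abs, Real.norm_eq_abs,
      abs_of_pos ht0, abs_of_nonneg hlog]
  have h3 := hC t ht0
  have ht32 : t ≤ t ^ (3 / 2 : ℝ) := by
    calc t = t ^ (1 : ℝ) := (Real.rpow_one t).symm
      _ ≤ t ^ (3 / 2 : ℝ) := Real.rpow_le_rpow_of_exponent_le ht (by norm_num)
  have hs32 : Real.sqrt t ≤ t ^ (3 / 2 : ℝ) := by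
    rw [Real.sqrt_eq_rpow]
    exact Real.rpow_le_rpow_of_exponent_le ht (by norm_num)
  have hnorm : |Rone t| = ‖(Rone t : ℂ)‖ := by rw [Complex.norm_real, Real.norm_eq_abs]
  rw [hnorm, Rone_eq_explicit ht]
  calc ‖-Zsum t - (t : ℂ) * Complex.log (2 * π) + psiOneRemainder t‖
      ≤ ‖-Zsum t - (t : ℂ) * Complex.log (2 * π)‖ + ‖psiOneRemainder t‖ := norm_add_le _ _
    _ ≤ ‖Zsum t‖ + ‖(t : ℂ) * Complex.log (2 * π)‖ + ‖psiOneRemainder t‖ := by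
        have := norm_sub_le (-Zsum t) ((t : ℂ) * Complex.log (2 * π))
        rw [norm_neg] at this
        linarith
    _ ≤ nicolasBeta * t ^ (3 / 2 : ℝ) + t * Real.log (2 * π) + C * Real.sqrt t := by
        rw [h2]; linarith
    _ ≤ (nicolasBeta + Real.log (2 * π) + C) * t ^ (3 / 2 : ℝ) := by
        nlinarith [mul_le_mul_of_nonneg_left ht32 hlog, mul_le_mul_of_nonneg_left hs32 hC0.le]

end NicolasJExplicit

end Literature.NumberTheory.LFunctions

end
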